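import Mathlib
import Literature.MathematicalPhysics.QuantumFieldTheory.Dimock2011to13.FreeFlowSingleStep

/-!
# Dimock, *The renormalization group according to Balaban* II, §2.5, proof of LEMMA 2.6 (`\label{bonfire}`): the identity
# «([Bal84b], p. 230) G′_j(□̃) = G_j(□̃) + a_j² G_j(□̃)Q_jᵀC_j(□̃ ∩ δΩ_{j+1})Q_jG_j(□̃)» — the NEXT-SCALE PROPAGATOR in
# terms of the current one and the fluctuation covariance — PROVED as a finite-dimensional operator identity
# (Woodbury), together with its `r`-family `G_{k,r} = G_k + a_k²G_kQ_kᵀC_{k,r}Q_kG_k` (the dual of part I, App. C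
# (lion)) and the identification of `G_{k,r=0}` with `G⁰_{k+1,Ω⁺}` of LEMMA 2.3 (eddie1)

**Citation header (reproduction of PUBLISHED work; template of the Bałaban lattice Yang–Mills cell).**
J. Dimock, *The renormalization group according to Balaban II. Large fields*, J. Math. Phys. **54** (2013) 092301
(= arXiv:1212.5562v2) [Dimock2013BalabanII], §2.5: LEMMA 2.6 `\label{bonfire}` L1185–1199 (= Lemma 2.6 of §2 under
`\newtheorem{lem}{Lemma}[section]`; TEMPLATE §9) and its proof L1224–1308, in particular the two-level case
L1252–1287 with the identity *"([Bal84b], p. 230)"* L1268–1271; §2.3 LEMMA 2.3 `\label{otto1}` (eddie1) L754–756;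
Lemma 3.5 `\label{th2}` proof (summer) L3382–3386; App. C `\label{moonshine}` LEMMA (z4) L6586–6601.  Part I: J. Dimock,
*The renormalization group according to Balaban I. Small fields*, Rev. Math. Phys. **25** (2013) 1330010 (=
arXiv:1108.1335v2) [Dimock2013], App. C `\label{C}` LEMMA (lion) L3521–3534 with its proof L3539–3581.  TeX line numbers
refer to the arXiv sources held by the cell on this hub at `run/shared/lean/archive/nearmiss/qft-balaban/dimock/src/
1212.5562/1212.5562.tex` (7217 lines, sha256[:16] 75c5792fc48eacbc) and `…/1108.1335/1108.1335.tex` (7382e6540dded9be).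
Dimock's *"[Bal84b]"* is T. Bałaban, *Propagators and renormalization transformations for lattice gauge theories II*,
Commun. Math. Phys. **96** (1984) 223–250 (the cell's B6; D2 bibliography L7118–7119); NOTHING of that paper is
asserted or formalised here — the identity is proved below from Dimock's own definitions.  Dimock's papers are
published and refereed and are the cell's TEMPLATE, not manuscripts under audit; no quantity of the Bałaban series
is touched.

**What the paper prints (verbatim).**  L1252–1272: *"It may happen that □̃ in not in a single δΩ_j. Suppose that □̃
intersects both δΩ_j and δΩ_{j+1}. Then G_{k,Ω}(□̃) = [−Δ_{□̃} + μ̄_k + a_jL^{2(k−j)}[Q_jᵀQ_j]_{□̃∩δΩ_j} +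
a_{j+1}L^{2(k−(j+1))}[Q_{j+1}ᵀQ_{j+1}]_{□̃∩δΩ_{j+1}}]^{−1}  … Again we scale up to 𝕋^{−j}_{𝖬+𝖭−j} where the propagator
becomes G′_j(□̃) ≡ [−Δ_{□̃} + μ̄_j + a_j[Q_jᵀQ_j]_{□̃∩δΩ_j} + (a_{j+1}/L²)[Q_jᵀQ_j]_{□̃∩δΩ_{j+1}}]^{−1}  We must establish that
G′_j(□̃) satisfies bounds of the form (gong1) … In this case we use the identity ([Bal84b], p. 230)  G′_j(□̃) = G_j(□̃)
+ a_j²G_j(□̃)Q_jᵀC_j(□̃ ∩ δΩ_{j+1})Q_jG_j(□̃)  Here all the pieces have pointwise bounds of the form we want and this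
yields the the result. For G_j(□̃) use (gong1) and for C_j(□̃ ∩ δΩ_j) see [Bal83b] or Appendix D in part I."*  (eddie1)
L754–756: *"G⁰_{k+1,Ω⁺} = [−Δ + μ̄_k + L^{−2}Q^T_{k+1,Ω⁺}𝐚^{(k+1)}Q_{k+1,Ω⁺}]^{−1}_{Ω_1}"*.  Part I, LEMMA (lion) L3521–3534:
*"C_{k,r} = A_{k,r} + a_k²A_{k,r}Q_kG_{k,r}Q_kᵀA_{k,r}  where A_{k,r} = (1/(a_k+r))(I − QᵀQ) + (1/(a_k + aL^{−2} + r))QᵀQ,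
G_{k,r} = (−Δ + μ̄_k + a_kQ_kᵀQ_k − a_k²Q_kᵀA_{k,r}Q_k)^{−1}"*, proof L3559–3563: *"Here we used (a_k + r +
aL^{−2}Q_kᵀQ_k)^{−1} = A_{k,r} which follows since Q_kᵀQ_k is a projection."*

**Why this module.**  TEMPLATE.md §4.2 row «D2 §2.5 random walk Thm `\label{th}` (L1326–1476), Lemma `\label{bonfire}`;
… identity "([Bal84b], p. 230)" G′_j(□̃) = G_j(□̃) + a_j²G_jQ_jᵀC_j(□̃∩δΩ_{j+1})Q_jG_j (L1268) …» listed this identity as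
a located item with NO kernel object (the row's kernel entries so far are BY NAME: the scaled distance, (funnysum), the
chain estimate).  The identity is the one place in the proof of LEMMA 2.6 where the two-level structure of the
multiscale propagator is handled, by reduction to one-level pieces; Dimock quotes it from Bałaban without proof.  It
is a finite-dimensional operator identity — the Woodbury identity with the capacitance matrix `−a_k^{−2}(Δ_k + aL·QᵀQ)`
— DUAL to part I's LEMMA (lion) (sibling `FluctuationCovarianceIdentity.Ckr_eq`, capacitance `−a_k^{−2}·G_{k,r}^{−1}`),
and it is also the content of (eddie1): the bracket of `G⁰_{k+1,Ω⁺}` is that of `G_{k,Ω⁺,r}` at `r = 0` (App. C (z4),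
sibling `MultiRegionFreeFlow.GkOr`; `FreeFlowSingleStep.gInvO_next`).  This module proves it, for every `r ≥ 0`, in
the finite index model the siblings already use, so that LEMMA 2.6's reduction and LEMMA 2.3's `G⁰_{k+1,Ω⁺}` are
expressed through `G_{k,Ω}` and the fluctuation covariance by a kernel theorem.

**What is reproduced here (kernel-checked, zero `sorry`).**  CARRIERS as in the siblings: sites `κ` (`D` = `[−Δ +
μ̄]` on them, any positive-definite matrix), unit-lattice variables `ι` with averaging `Q_k : Matrix ι κ ℝ` and weight
`a_k > 0`, the next averaging `Q : Matrix σ ι ℝ` with `QQᵀ = I` (`Q_{k+1} = QQ_k`), `aL = a/L² ≥ 0`, `a′ =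
FreeFlowSingleStep.aNext a_k aL = a_kaL/(a_k + aL)` (`= a_{k+1}L^{−2}`); in §2 additionally layers `τ` with weight
`𝐚_τ ≥ 0` and rows `Q_τ` (`E = Q_τᵀ𝐚_τQ_τ`).
* §1 ONE REGION (`FluctuationCovarianceIdentity`'s `Gk`, `Gkr`, `Ckr`, `Akr`, `Deltak`, `gkrInv`): `gkrInv_eq_add_conj`
  (Woodbury shape of the bracket of `G_{k,r}`), `Akr_mul_base` (`A_{k,r}` is a two-sided inverse of `a_k + r + aL·QᵀQ`),
  private `mid_mul`∕`mid_isUnit`∕`mid_inv` (`(−a_k²A_{k,r})^{−1} = −a_k^{−2}(a_k + r + aL·QᵀQ)`), `gkInv_mul_Gk`, `gkInv_inv`,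
  **`cap_eq`** (the capacitance matrix `(−a_k²A_{k,r})^{−1} + Q_kG_kQ_kᵀ = −a_k^{−2}(Δ_k + aL·QᵀQ + r) = −a_k^{−2}C_{k,r}^{−1}`),
  private `cap_mul`; **`Gkr_eq_Gk_add`**: `G_{k,r} = G_k + a_k²G_kQ_kᵀC_{k,r}Q_kG_k` for all `r ≥ 0` (Mathlib's Woodbury
  `Matrix.add_mul_mul_inv_eq_sub`); `gkrInv_mul_Gk_add` (the same as the right-inverse equation);
  **`gkrInv_zero_eq`**∕**`Gkr_zero_eq`** (at `r = 0` the bracket is the next-scale one, `D + a′Q_{k+1}ᵀQ_{k+1}`, by (summer));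
  **`nextScale_eq_Gk_add`**: `(D + a′Q_{k+1}ᵀQ_{k+1})^{−1} = G_k + a_k²G_kQ_kᵀC_{k,0}Q_kG_k` — *"([Bal84b], p. 230)"* in one
  region.
* §2 MULTI-REGION (`MultiRegionFreeFlow`'s `GkO`, `GkOr`, `CkOr`, `weightO`, `rowsO`; `FreeFlowSingleStep.gInvO_next`):
  private `restE_posSemidef`; **`GkOr_eq_GkO_add`** (`G_{k,Ω⁺,r} = G_{k,Ω} + a_k²G_{k,Ω}Q_kᵀC_{k,Ω⁺,r}Q_kG_{k,Ω}`, all `r ≥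
  0`, = §1 at `D + E`); **`GkO_next_eq_GkOr_zero`** (`G⁰_{k+1,Ω⁺} = G_{k,Ω⁺,0}`); **`GkO_next_eq`**: `G⁰_{k+1,Ω⁺} = G_{k,Ω} +
  a_k²G_{k,Ω}Q_kᵀC_{k,Ω⁺}Q_kG_{k,Ω}` — THE IDENTITY *"([Bal84b], p. 230)"* with the dictionary for LEMMA 2.6 in its
  docstring (`G_j(□̃)` ↦ `GkO`, `G′_j(□̃)` ↦ the left side, `C_j(□̃ ∩ δΩ_{j+1})` ↦ `CkOr … 0`, the kept terms
  `a_j[Q_jᵀQ_j]_{□̃∩δΩ_j}` ↦ `E`); `GkO_next_mulVec` (applied to a source).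
* §3 a one-site non-vacuity `example` (`(1 + ½)^{−1} = ½ + ½·⅔·½`).

**Readings / located items (declared).**  (i) FINITE INDEX MODEL as in the siblings: `D` is any positive-definite
matrix (for LEMMA 2.6: `[−Δ_{□̃} + μ̄_j]` with the Neumann∕Dirichlet conventions of L1164–1168 — only `D > 0` is used);
the sub-region `□̃ ∩ δΩ_{j+1}` where the averaging term is replaced is the `ι`-block, everything kept is in `E =
Q_τᵀ𝐚_τQ_τ`.  (ii) `C_j(□̃ ∩ δΩ_{j+1})`, for which the print refers to *"[Bal83b] or Appendix D in part I"* without a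
formula, is READ as the fluctuation covariance of the step restricted to that block, `[Δ_j(□̃) + (a/L²)QᵀQ]^{−1}` with
`Δ_j(□̃) = a_j − a_j²Q_jG_j(□̃)Q_jᵀ` (`MultiRegionFreeFlow.CkOr … 0`, part I (one)∕(spiffy)) — with this reading the
printed identity is an exact theorem (`GkO_next_eq`); it is the ONLY reading under which the display L1270 holds with
`G_j(□̃)` as printed (the capacitance computation `cap_eq` forces it).  (iii) L1265 prints `(a_{j+1}/L²)[Q_jᵀQ_j]_{□̃∩δΩ_{j+1}}`
where the unscaled display L1255–1256 has `a_{j+1}L^{2(k−(j+1))}[Q_{j+1}ᵀQ_{j+1}]_{□̃∩δΩ_{j+1}}` and scaling by `L^{k−j}` does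
not change the averaging operators: read `Q_{j+1}ᵀQ_{j+1} = (QQ_j)ᵀ(QQ_j)` (located misprint candidate, immaterial; it is
what (eddie1) and `FreeFlowSingleStep.gInvO_next` have).  (iv) `a′ = a_kaL/(a_k + aL)` stands for `a_{k+1}L^{−2}` (part I
(ak) L516–518, as in `FreeFlowSingleStep`).  (v) L1272 prints *"C_j(□̃ ∩ δΩ_j)"* where L1270 has `C_j(□̃ ∩ δΩ_{j+1})`, and
*"the the result"* — located typos, immaterial.

**What is NOT claimed.**  The BOUNDS of LEMMA 2.6 ((lefty), (gong1)–(gong3): *"These are already established; see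
[Bal83b] or Appendix D in part I"*), the pointwise bounds on `C_j(□̃ ∩ δΩ_{j+1})`, the `L²`-to-pointwise step L1290–1306,
the piece L1274–1283 (`d(y,y″) ≥ d(y,y′) − L`), THEOREM 2.2; anything printed in [Bal84b]∕B6 itself (Dimock's pointer
"p. 230" is recorded, not audited); anything of B1–B16 (TEMPLATE row «D2 §2.5» B-side loci B6 Lemma 2.1, Props 2.2–2.3,
§C, Props 2.5–2.7, Cor 2.8; B9 §C–D — untouched, grade T unchanged).  NOT summit progress; NOT a statement about any
Bałaban paper; NOT continuum; NOT Clay.  NEW leaf; imports Mathlib + `FreeFlowSingleStep` (hence `MultiRegionFreeFlow`,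
`FluctuationCovarianceIdentity`); no Summits import; modifies nothing.  Unit `b2b-balaban-template` gen 36 (journal CLAIM
D2-BAL84B-P230-IDENTITY-KERNEL).

**Version.**  v1 (gen 36, literature-prover-b2b-balaban-template-g36-0, 2026-08-20).
-/

noncomputable section

namespace Literature.MathematicalPhysics.QuantumFieldTheory.Dimock2011to13.NextScalePropagatorIdentity

open Matrix
open scoped Matrix
open Literature.MathematicalPhysics.QuantumFieldTheory.Dimock2011to13.FluctuationCovarianceIdentity
open Literature.MathematicalPhysics.QuantumFieldTheory.Dimock2011to13.MultiRegionFreeFlow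
open Literature.MathematicalPhysics.QuantumFieldTheory.Dimock2011to13.FreeFlowSingleStep

variable {κ ι σ : Type*} [Fintype κ] [Fintype ι] [Fintype σ] [DecidableEq κ] [DecidableEq ι] [DecidableEq σ]

/-! ## §1 The single-region identity `G_{k,r} = G_k + a_k² G_k Q_kᵀ C_{k,r} Q_k G_k` (all `r ≥ 0`) -/

section Single

variable {D : Matrix κ κ ℝ} {Qk : Matrix ι κ ℝ} {Q : Matrix σ ι ℝ} {ak aL r : ℝ}

omit [Fintype κ] [DecidableEq κ] [DecidableEq σ] in
/-- the bracket of `G_{k,r}` in Woodbury shape: `D + a_kQ_kᵀQ_k − a_k²Q_kᵀA_{k,r}Q_k = (D + a_kQ_kᵀQ_k) + Q_kᵀ(−a_k²A_{k,r})Q_k`.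
[cite: Dimock2013, App. C Lemma (lion) L3527–3533 (arXiv:1108.1335v2 TeX)] -/
theorem gkrInv_eq_add_conj :
    gkrInv D Qk Q ak aL r = (D + ak • (Qkᵀ * Qk)) + Qkᵀ * (-(ak ^ 2) • Akr Q ak aL r) * Qk := by
  unfold gkrInv
  rw [Matrix.mul_smul, Matrix.smul_mul, neg_smul, sub_eq_add_neg]

omit [Fintype κ] [DecidableEq κ] in
/-- `A_{k,r}` is also a LEFT inverse of `a_k + r + aL·QᵀQ`. [cite: Dimock2013, App. C L3559–3563 «(a_k + r + aL^{−2}Q_kᵀQ_k)^{−1}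
= A_{k,r} which follows since Q_kᵀQ_k is a projection» (arXiv:1108.1335v2 TeX)] -/
theorem Akr_mul_base (hQ : Q * Qᵀ = 1) (h1 : ak + r ≠ 0) (h2 : ak + aL + r ≠ 0) :
    Akr Q ak aL r * ((ak + r) • (1 : Matrix ι ι ℝ) + aL • proj Q) = 1 := by
  rw [mul_eq_one_comm]
  exact base_mul_Akr hQ h1 h2

omit [Fintype κ] [DecidableEq κ] in
/-- the middle factor of the Woodbury identity, `−a_k²A_{k,r}`, times `−a_k^{−2}(a_k + r + aL·QᵀQ)` is `1`. [folklore] -/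
private theorem mid_mul (hQ : Q * Qᵀ = 1) (hak : 0 < ak) (h1 : ak + r ≠ 0) (h2 : ak + aL + r ≠ 0) :
    (-(ak ^ 2) • Akr Q ak aL r) * (-(ak ^ 2)⁻¹ • ((ak + r) • (1 : Matrix ι ι ℝ) + aL • proj Q)) = 1 := by
  have hak2 : ak ^ 2 ≠ 0 := by positivity
  rw [Matrix.smul_mul, Matrix.mul_smul, smul_smul, Akr_mul_base hQ h1 h2, neg_mul_neg, mul_inv_cancel₀ hak2,
    one_smul]

omit [Fintype κ] [DecidableEq κ] in
/-- `−a_k²A_{k,r}` is invertible … [folklore] -/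
private theorem mid_isUnit (hQ : Q * Qᵀ = 1) (hak : 0 < ak) (h1 : ak + r ≠ 0) (h2 : ak + aL + r ≠ 0) :
    IsUnit (-(ak ^ 2) • Akr Q ak aL r) :=
  (Matrix.isUnit_iff_isUnit_det _).mpr (Matrix.isUnit_det_of_right_inverse (mid_mul hQ hak h1 h2))

omit [Fintype κ] [DecidableEq κ] in
/-- … with inverse `−a_k^{−2}(a_k + r + aL·QᵀQ)`. [folklore] -/
private theorem mid_inv (hQ : Q * Qᵀ = 1) (hak : 0 < ak) (h1 : ak + r ≠ 0) (h2 : ak + aL + r ≠ 0) :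
    (-(ak ^ 2) • Akr Q ak aL r)⁻¹ = -(ak ^ 2)⁻¹ • ((ak + r) • (1 : Matrix ι ι ℝ) + aL • proj Q) :=
  Matrix.inv_eq_right_inv (mid_mul hQ hak h1 h2)

omit [DecidableEq ι] in
/-- the bracket of `G_k` times `G_k` is `1` (`D > 0`, `a_k > 0`). [cite: Dimock2013, §2.2 L594–597 (arXiv:1108.1335v2 TeX)] -/
theorem gkInv_mul_Gk (hD : D.PosDef) (hak : 0 < ak) : (D + ak • (Qkᵀ * Qk)) * Gk D Qk ak = 1 := by
  unfold Gk
  exact Matrix.mul_nonsing_inv _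
    ((Matrix.isUnit_iff_isUnit_det _).mp (gkInv_posDef (Qk := Qk) hD hak).isUnit)

omit [DecidableEq ι] in
/-- the bracket of `G_k` is invertible. [folklore] -/
private theorem gkInv_isUnit (hD : D.PosDef) (hak : 0 < ak) : IsUnit (D + ak • (Qkᵀ * Qk)) :=
  (gkInv_posDef (Qk := Qk) hD hak).isUnit

omit [DecidableEq ι] in
/-- `(D + a_kQ_kᵀQ_k)^{−1} = G_k` (definitional, recorded for rewriting). [cite: Dimock2013, §2.2 L594–597
(arXiv:1108.1335v2 TeX)] -/
theorem gkInv_inv : (D + ak • (Qkᵀ * Qk))⁻¹ = Gk D Qk ak := rfl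

/-- **the capacitance matrix of this Woodbury identity is `−a_k^{−2}·C_{k,r}^{−1}`**:
`(−a_k²A_{k,r})^{−1} + Q_kG_kQ_kᵀ = −a_k^{−2}(Δ_k + aL·QᵀQ + r)` with `Δ_k = a_k − a_k²Q_kG_kQ_kᵀ`.
[cite: Dimock2013, §2.2 (spiffy) L631–636 and §4.2 (one) L2087–2093 (arXiv:1108.1335v2 TeX)] -/
theorem cap_eq (hQ : Q * Qᵀ = 1) (hak : 0 < ak) (h1 : ak + r ≠ 0) (h2 : ak + aL + r ≠ 0) :
    (-(ak ^ 2) • Akr Q ak aL r)⁻¹ + Qk * (D + ak • (Qkᵀ * Qk))⁻¹ * Qkᵀ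
      = -(ak ^ 2)⁻¹ • (Deltak D Qk ak + aL • proj Q + r • (1 : Matrix ι ι ℝ)) := by
  rw [mid_inv hQ hak h1 h2, gkInv_inv]
  unfold Deltak
  have hak2 : ak ^ 2 ≠ 0 := by positivity
  ext i j
  simp only [Matrix.add_apply, Matrix.smul_apply, Matrix.sub_apply, smul_eq_mul]
  field_simp
  ring

/-- the capacitance matrix times `−a_k²C_{k,r}` is `1`. [folklore] -/
private theorem cap_mul (hD : D.PosDef) (hQ : Q * Qᵀ = 1) (hak : 0 < ak) (haL : 0 ≤ aL) (hr : 0 ≤ r) :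
    (-(ak ^ 2)⁻¹ • (Deltak D Qk ak + aL • proj Q + r • (1 : Matrix ι ι ℝ))) * (-(ak ^ 2) • Ckr D Qk Q ak aL r)
      = 1 := by
  have hak2 : ak ^ 2 ≠ 0 := by positivity
  have hCC : (Deltak D Qk ak + aL • proj Q + r • (1 : Matrix ι ι ℝ)) * Ckr D Qk Q ak aL r = 1 := by
    rw [mul_eq_one_comm]
    exact (Ckr_mul_eq_one_and_eq hD hQ hak haL hr).1
  rw [Matrix.smul_mul, Matrix.mul_smul, smul_smul, hCC, neg_mul_neg, inv_mul_cancel₀ hak2, one_smul]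

/-- **`G_{k,r} = G_k + a_k² G_k Q_kᵀ C_{k,r} Q_k G_k` for every `r ≥ 0`** (`D = −Δ + μ̄_k > 0`, `QQᵀ = I`, `a_k > 0`,
`aL = a/L² ≥ 0`): the propagator `G_{k,r} = (−Δ + μ̄_k + a_kQ_kᵀQ_k − a_k²Q_kᵀA_{k,r}Q_k)^{−1}` of part I App. C in terms of
`G_k` and the fluctuation covariance `C_{k,r} = (Δ_k + aL·QᵀQ + r)^{−1}` — the companion ("dual Woodbury") of the printed
LEMMA (lion) `C_{k,r} = A_{k,r} + a_k²A_{k,r}Q_kG_{k,r}Q_kᵀA_{k,r}`, and at `r = 0` the identity *"([Bal84b], p. 230)"* of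
[Dimock2013BalabanII] L1264–1272 (§2 below). [cite: Dimock2013BalabanII, §2.5 Lemma bonfire proof L1264–1272
(arXiv:1212.5562v2 TeX); Dimock2013, App. C Lemma (lion) L3521–3534 (arXiv:1108.1335v2 TeX)] -/
theorem Gkr_eq_Gk_add (hD : D.PosDef) (hQ : Q * Qᵀ = 1) (hak : 0 < ak) (haL : 0 ≤ aL) (hr : 0 ≤ r) :
    Gkr D Qk Q ak aL r
      = Gk D Qk ak + ak ^ 2 • (Gk D Qk ak * Qkᵀ * Ckr D Qk Q ak aL r * Qk * Gk D Qk ak) := by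
  have h1 : ak + r ≠ 0 := by linarith
  have h2 : ak + aL + r ≠ 0 := by linarith
  -- the three invertibilities of the Woodbury identity
  have hA := gkInv_isUnit (Qk := Qk) hD hak
  have hC := mid_isUnit (ι := ι) hQ hak h1 h2
  have hcapU : IsUnit ((-(ak ^ 2) • Akr Q ak aL r)⁻¹ + Qk * (D + ak • (Qkᵀ * Qk))⁻¹ * Qkᵀ) := by
    rw [cap_eq hQ hak h1 h2]
    exact (Matrix.isUnit_iff_isUnit_det _).mpr (Matrix.isUnit_det_of_right_inverse (cap_mul hD hQ hak haL hr))
  have hcapInv : ((-(ak ^ 2) • Akr Q ak aL r)⁻¹ + Qk * (D + ak • (Qkᵀ * Qk))⁻¹ * Qkᵀ)⁻¹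
      = -(ak ^ 2) • Ckr D Qk Q ak aL r := by
    rw [cap_eq hQ hak h1 h2]
    exact Matrix.inv_eq_right_inv (cap_mul hD hQ hak haL hr)
  unfold Gkr
  rw [gkrInv_eq_add_conj, Matrix.add_mul_mul_inv_eq_sub _ _ _ _ hA hC hcapU, hcapInv, gkInv_inv]
  rw [Matrix.mul_smul, Matrix.smul_mul, Matrix.smul_mul, neg_smul, sub_neg_eq_add]

/-- the same identity as the RIGHT-INVERSE EQUATION of the bracket of `G_{k,r}`:
`(−Δ + μ̄_k + a_kQ_kᵀQ_k − a_k²Q_kᵀA_{k,r}Q_k)(G_k + a_k²G_kQ_kᵀC_{k,r}Q_kG_k) = I`. [cite: Dimock2013, App. C Lemma (lion)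
L3527–3533 (arXiv:1108.1335v2 TeX)] -/
theorem gkrInv_mul_Gk_add (hD : D.PosDef) (hQ : Q * Qᵀ = 1) (hak : 0 < ak) (haL : 0 ≤ aL) (hr : 0 ≤ r) :
    gkrInv D Qk Q ak aL r * (Gk D Qk ak + ak ^ 2 • (Gk D Qk ak * Qkᵀ * Ckr D Qk Q ak aL r * Qk * Gk D Qk ak))
      = 1 := by
  rw [← Gkr_eq_Gk_add hD hQ hak haL hr]
  unfold Gkr
  exact Matrix.mul_nonsing_inv _
    ((Matrix.isUnit_iff_isUnit_det _).mp (gkrInv_posDef hD hQ hak haL hr).isUnit)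

omit [Fintype κ] [DecidableEq κ] [DecidableEq σ] in
/-- at `r = 0` the bracket of `G_{k,0}` is the NEXT-SCALE bracket `D + a′Q_{k+1}ᵀQ_{k+1}`, `Q_{k+1} = QQ_k`,
`a′ = a_k·aL/(a_k + aL)` (`= a_{k+1}L^{−2}`): by (summer) at `r = 0`, `a_kQ_kᵀB_{k,0}Q_k = (a_k²aL/(a_k(a_k+aL)))Q_{k+1}ᵀQ_{k+1}`.
[cite: Dimock2013BalabanII, Lemma th2 proof (summer) L3382–3386 and Lemma 2.3 (eddie1) L754–756 (arXiv:1212.5562v2 TeX)] -/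
theorem gkrInv_zero_eq (hak : ak ≠ 0) (h2 : ak + aL ≠ 0) :
    gkrInv D Qk Q ak aL 0 = D + aNext ak aL • ((Q * Qk)ᵀ * (Q * Qk)) := by
  have h1 : ak + 0 ≠ 0 := by rwa [add_zero]
  have h2' : ak + aL + 0 ≠ 0 := by rwa [add_zero]
  rw [gkrInv_eq h1 h2', smul_conj_Bkr_eq h1 h2']
  have e1 : ak * 0 / (ak + 0) = 0 := by simp
  have e2 : ak ^ 2 * aL / ((ak + 0) * (ak + aL + 0)) = aNext ak aL := by
    unfold aNext
    rw [add_zero, add_zero]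
    field_simp
  rw [e1, zero_smul, zero_add, e2]

omit [DecidableEq σ] in
/-- hence **`G_{k,0}` IS the next-scale propagator** `(D + a′Q_{k+1}ᵀQ_{k+1})^{−1}` (= `G⁰_{k+1}` of (eddie1) in the
one-region case; = `G′_j(□̃)` of the proof of Lemma 2.6 after scaling, with `a′ = a_{j+1}/L²`).
[cite: Dimock2013BalabanII, Lemma 2.3 (eddie1) L754–756 and §2.5 Lemma bonfire proof L1259–1264 (arXiv:1212.5562v2 TeX)] -/
theorem Gkr_zero_eq (hak : ak ≠ 0) (h2 : ak + aL ≠ 0) :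
    Gkr D Qk Q ak aL 0 = (D + aNext ak aL • ((Q * Qk)ᵀ * (Q * Qk)))⁻¹ := by
  unfold Gkr
  rw [gkrInv_zero_eq hak h2]

/-- **«([Bal84b], p. 230)» in the one-region model**: `(D + a′Q_{k+1}ᵀQ_{k+1})^{−1} = G_k + a_k²G_kQ_kᵀC_kQ_kG_k` with
`C_k = C_{k,0} = (Δ_k + aL·QᵀQ)^{−1}` the fluctuation covariance and `a′ = a_ka L^{−2}/(a_k + aL^{−2}) = a_{k+1}L^{−2}`.
[cite: Dimock2013BalabanII, §2.5 Lemma bonfire proof L1264–1272 «In this case we use the identity ([Bal84b], p. 230)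
G′_j(□̃) = G_j(□̃) + a_j²G_j(□̃)Q_jᵀC_j(□̃ ∩ δΩ_{j+1})Q_jG_j(□̃)» (arXiv:1212.5562v2 TeX)] -/
theorem nextScale_eq_Gk_add (hD : D.PosDef) (hQ : Q * Qᵀ = 1) (hak : 0 < ak) (haL : 0 ≤ aL) :
    (D + aNext ak aL • ((Q * Qk)ᵀ * (Q * Qk)))⁻¹
      = Gk D Qk ak + ak ^ 2 • (Gk D Qk ak * Qkᵀ * Ckr D Qk Q ak aL 0 * Qk * Gk D Qk ak) := by
  rw [← Gkr_zero_eq hak.ne' (by linarith)]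
  exact Gkr_eq_Gk_add hD hQ hak haL le_rfl

end Single

/-! ## §2 The multi-region form: LEMMA 2.6's `G′_j(□̃)`, `G_j(□̃)`, `C_j(□̃ ∩ δΩ_{j+1})` and LEMMA 2.3's `G⁰_{k+1,Ω⁺}` -/

section Multi

variable {τ : Type*} [Fintype τ]
variable {D : Matrix κ κ ℝ} {ak : ℝ} {aτ : Matrix τ τ ℝ} {Qk : Matrix ι κ ℝ} {Qτ : Matrix τ κ ℝ} {Q : Matrix σ ι ℝ}
  {aL r : ℝ}

omit [DecidableEq κ] in
/-- `E = Q_τᵀ𝐚_τQ_τ ≥ 0` for `𝐚_τ ≥ 0` (the kept averaging terms `a_j[Q_jᵀQ_j]_{□̃ ∩ δΩ_j}`, or `[Q_{k,Ω}ᵀ𝐚Q_{k,Ω}]_{Ω_{k+1}ᶜ}`).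
[folklore] -/
private theorem restE_posSemidef (haτ : aτ.PosSemidef) (Qτ : Matrix τ κ ℝ) : (restE aτ Qτ).PosSemidef := by
  have h := haτ.conjTranspose_mul_mul_same Qτ
  rw [conjTranspose_eq_transpose_of_trivial] at h
  exact h

/-- **the multi-region `r`-family**: `G_{k,Ω⁺,r} = G_{k,Ω} + a_k² G_{k,Ω} Q_kᵀ C_{k,Ω⁺,r} Q_k G_{k,Ω}` for every `r ≥ 0`
(`D = [−Δ + μ̄_k]_{Ω₁} > 0`, layer weights `𝐚_τ ≥ 0`, `QQᵀ = I`, `a_k > 0`, `aL ≥ 0`) — the one-region identity at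
`D ↦ D + E`, exactly as App. C's (z4) is (lion) at `D + E` (`MultiRegionFreeFlow.CkOr_eq`). [cite: Dimock2013BalabanII,
App. C Lemma (z4) L6586–6601 and §2.5 Lemma bonfire proof L1264–1272 (arXiv:1212.5562v2 TeX)] -/
theorem GkOr_eq_GkO_add (hD : D.PosDef) (haτ : aτ.PosSemidef) (hQ : Q * Qᵀ = 1) (hak : 0 < ak) (haL : 0 ≤ aL)
    (hr : 0 ≤ r) :
    GkOr D ak aτ Qk Qτ Q aL r
      = GkO D (weightO ak aτ) (rowsO Qk Qτ)
        + ak ^ 2 • (GkO D (weightO ak aτ) (rowsO Qk Qτ) * Qkᵀ * CkOr D ak aτ Qk Qτ Q aL r * Qk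
            * GkO D (weightO ak aτ) (rowsO Qk Qτ)) := by
  rw [GkOr_eq_Gkr (by linarith) (by linarith), GkO_block, CkOr_eq_Ckr]
  exact Gkr_eq_Gk_add (hD.add_posSemidef (restE_posSemidef haτ Qτ)) hQ hak haL hr

/-- at `r = 0`, `G_{k,Ω⁺,0}` IS `G⁰_{k+1,Ω⁺}` of LEMMA 2.3 (eddie1): both have the bracket `(D + E) + a′Q_{k+1}ᵀQ_{k+1}`
(`FreeFlowSingleStep.gInvO_next`). [cite: Dimock2013BalabanII, Lemma 2.3 (eddie1) L754–756 and proof L823–829; App. C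
(z4) L6592–6599 (arXiv:1212.5562v2 TeX)] -/
theorem GkO_next_eq_GkOr_zero (hak : ak ≠ 0) (h2 : ak + aL ≠ 0) :
    GkO D (weightO (aNext ak aL) aτ) (rowsO (Q * Qk) Qτ) = GkOr D ak aτ Qk Qτ Q aL 0 := by
  have h1 : ak + 0 ≠ 0 := by rwa [add_zero]
  have h2' : ak + aL + 0 ≠ 0 := by rwa [add_zero]
  unfold GkO
  rw [gInvO_next, GkOr_eq_Gkr h1 h2', Gkr_zero_eq hak h2]

/-- **THE IDENTITY «([Bal84b], p. 230)» AS USED IN THE PROOF OF LEMMA 2.6, and (eddie1) in terms of `G_{k,Ω}`**: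
`G⁰_{k+1,Ω⁺} = G_{k,Ω} + a_k² G_{k,Ω} Q_kᵀ C_{k,Ω⁺} Q_k G_{k,Ω}` with `C_{k,Ω⁺} = [Δ_{k,Ω} + (a/L²)QᵀQ]^{−1}_{Ω_{k+1}}` the
fluctuation covariance of the step.  DICTIONARY for LEMMA 2.6 (after scaling to `𝕋^{−j}`): sites `κ` = `□̃`, `D = [−Δ +
μ̄_j]_{□̃}` (Neumann), `τ`-rows = `[Q_j]_{□̃ ∩ δΩ_j}` with weight `a_j`, `ι`-rows = `[Q_j]_{□̃ ∩ δΩ_{j+1}}` with weight `a_j`,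
`Q` the one-step averaging on `(□̃ ∩ δΩ_{j+1})^{(j)}`, `aL = a/L²`, `a′ = a_{j+1}/L²`; then `G_j(□̃) = GkO …`, `G′_j(□̃) =`
the left side, `C_j(□̃ ∩ δΩ_{j+1}) = CkOr … 0`. [cite: Dimock2013BalabanII, §2.5 Lemma bonfire proof L1259–1272 «Again
we scale up to 𝕋^{−j}_{𝖬+𝖭−j} where the propagator becomes G′_j(□̃) ≡ [−Δ_{□̃} + μ̄_j + a_j[Q_jᵀQ_j]_{□̃∩δΩ_j} +
(a_{j+1}/L²)[Q_jᵀQ_j]_{□̃∩δΩ_{j+1}}]^{−1} … In this case we use the identity ([Bal84b], p. 230) G′_j(□̃) = G_j(□̃) +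
a_j²G_j(□̃)Q_jᵀC_j(□̃ ∩ δΩ_{j+1})Q_jG_j(□̃)  Here all the pieces have pointwise bounds of the form we want and this
yields the the result»; Lemma 2.3 (eddie1) L754–756 (arXiv:1212.5562v2 TeX)] -/
theorem GkO_next_eq (hD : D.PosDef) (haτ : aτ.PosSemidef) (hQ : Q * Qᵀ = 1) (hak : 0 < ak) (haL : 0 ≤ aL) :
    GkO D (weightO (aNext ak aL) aτ) (rowsO (Q * Qk) Qτ)
      = GkO D (weightO ak aτ) (rowsO Qk Qτ)
        + ak ^ 2 • (GkO D (weightO ak aτ) (rowsO Qk Qτ) * Qkᵀ * CkOr D ak aτ Qk Qτ Q aL 0 * Qk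
            * GkO D (weightO ak aτ) (rowsO Qk Qτ)) := by
  rw [GkO_next_eq_GkOr_zero hak.ne' (by linarith)]
  exact GkOr_eq_GkO_add hD haτ hQ hak haL le_rfl

/-- applied to a source: `G⁰_{k+1,Ω⁺}f = G_{k,Ω}f + a_k²G_{k,Ω}Q_kᵀC_{k,Ω⁺}Q_kG_{k,Ω}f` — the form in which *"all the
pieces have pointwise bounds of the form we want"* is used. [cite: Dimock2013BalabanII, §2.5 Lemma bonfire proof
L1266–1272 (arXiv:1212.5562v2 TeX)] -/
theorem GkO_next_mulVec (hD : D.PosDef) (haτ : aτ.PosSemidef) (hQ : Q * Qᵀ = 1) (hak : 0 < ak) (haL : 0 ≤ aL)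
    (f : κ → ℝ) :
    GkO D (weightO (aNext ak aL) aτ) (rowsO (Q * Qk) Qτ) *ᵥ f
      = GkO D (weightO ak aτ) (rowsO Qk Qτ) *ᵥ f
        + ak ^ 2 • (GkO D (weightO ak aτ) (rowsO Qk Qτ) *ᵥ (Qkᵀ *ᵥ (CkOr D ak aτ Qk Qτ Q aL 0 *ᵥ
            (Qk *ᵥ (GkO D (weightO ak aτ) (rowsO Qk Qτ) *ᵥ f))))) := by
  rw [GkO_next_eq hD haτ hQ hak haL, add_mulVec, smul_mulVec]
  simp only [← mulVec_mulVec]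

end Multi

/-! ## §3 Non-vacuity: a one-site instance -/

/-- `D = 1`, `Q_k = Q = 1`, `a_k = 1`, `aL = 1`, `r = 0`: `G_k = ½`, `Δ_k = 1 − ½ = ½`, `C_{k,0} = (½ + 1)^{−1} = ⅔`, `a′ = ½`,
and the identity reads `(1 + ½)^{−1} = ½ + ½·⅔·½ = ⅔`. -/
example :
    ((1 : Matrix Unit Unit ℝ) + aNext 1 1 •
        (((1 : Matrix Unit Unit ℝ) * (1 : Matrix Unit Unit ℝ))ᵀ * ((1 : Matrix Unit Unit ℝ) * (1 : Matrix Unit Unit ℝ))))⁻¹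
    = Gk (1 : Matrix Unit Unit ℝ) (1 : Matrix Unit Unit ℝ) 1
      + (1 : ℝ) ^ 2 • (Gk (1 : Matrix Unit Unit ℝ) (1 : Matrix Unit Unit ℝ) 1 * (1 : Matrix Unit Unit ℝ)ᵀ *
          Ckr (1 : Matrix Unit Unit ℝ) (1 : Matrix Unit Unit ℝ) (1 : Matrix Unit Unit ℝ) 1 1 0 *
          (1 : Matrix Unit Unit ℝ) * Gk (1 : Matrix Unit Unit ℝ) (1 : Matrix Unit Unit ℝ) 1) :=
  nextScale_eq_Gk_add Matrix.PosDef.one (by simp) one_pos zero_le_one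

end Literature.MathematicalPhysics.QuantumFieldTheory.Dimock2011to13.NextScalePropagatorIdentity
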